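import Summits.Ventures.PackingBounds.Configurations.OrthogonalPentagonsUnique
import HarnessLib

/-!
# Ten-point `{0, cos 72°, cos 144°}`-codes in `ℝ⁴`: the distance distribution and the energy of every pair potential

Framing: lottery ticket; floor = certified bounds/negative ranges. Venture `PackingBounds` (cell
`pub-packcert`, seat `pub-packcert-energy` gen 14). From the structure theorem
`OrthogonalPentagonsUnique.structure_thm` (a ten-point code with vanishing Gram row sums is the disjoint union of two
`144°`-walk pentagons in orthogonal planes): every point has exactly two partners at `c₂ = cos 144°`, two at
`c₁ = cos 72°` and five orthogonal ones, so for every pair potential `a` the energy over ordered pairs is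
`10 · (2 a(c₂) + 2 a(c₁) + 5 a(0))` (`energy_eq`). Used for the ground-state energies of the `(1+t)^k` problems of
ten points on `S³` (`Energy.TenPointCkFour/Five`).
-/

noncomputable section

namespace Summit.Ventures.PackingBounds.Config.OrthogonalPentagonsUnique

open Finset
open scoped RealInnerProductSpace

variable {C : Finset E4}

/-- Row sum of a potential over one pentagon: `Σ_{j<5} a(gv i j) = a(1) + 2a(c₂) + 2a(c₁)`. -/
theorem sum_gv_range (a : ℝ → ℝ) (i : ℕ) (hi : i ≤ 4) :
    ∑ j ∈ Finset.range 5, a (gv i j) = a 1 + (2 * a ctwo + 2 * a cone) := by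
  interval_cases i <;> simp [Finset.sum_range_succ, gv] <;> ring

/-- Sum over the walk pentagon as a sum over indices (the walk is injective on `range 5`). -/
theorem sum_image_wk {x0 x1 : E4} (h0 : ‖x0‖ = 1) (h1 : ‖x1‖ = 1) (h01 : inner ℝ x0 x1 = ctwo) (f : E4 → ℝ)
    (s : Finset ℕ) (hs : s ⊆ Finset.range 5) :
    ∑ y ∈ s.image (wk x0 x1), f y = ∑ j ∈ s, f (wk x0 x1 j) := by
  rw [Finset.sum_image]
  intro i hi j hj hij
  by_contra h
  have hi' := Finset.mem_range.1 (hs hi)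
  have hj' := Finset.mem_range.1 (hs hj)
  exact wk_ne h0 h1 h01 (by omega) (by omega) h hij

/-- The row of a pentagon point: `Σ_{y ∈ C, y ≠ p_i} a⟪p_i, y⟫ = 2a(c₂) + 2a(c₁) + 5a(0)` when `C = P ∪ Q` with `Q ⟂ P`. -/
theorem row_sum {x0 x1 y0 y1 : E4} (h0 : ‖x0‖ = 1) (h1 : ‖x1‖ = 1) (h01 : inner ℝ x0 x1 = ctwo)
    (k0 : ‖y0‖ = 1) (k1 : ‖y1‖ = 1) (k01 : inner ℝ y0 y1 = ctwo)
    (hcross : ∀ i j, i ≤ 4 → j ≤ 4 → inner ℝ (wk x0 x1 i) (wk y0 y1 j) = 0)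
    (hCeq : C = (Finset.range 5).image (wk x0 x1) ∪ (Finset.range 5).image (wk y0 y1))
    (a : ℝ → ℝ) (i : ℕ) (hi : i ≤ 4) :
    ∑ y ∈ C.erase (wk x0 x1 i), a (inner ℝ (wk x0 x1 i) y) = 2 * a ctwo + 2 * a cone + 5 * a 0 := by
  classical
  have hg := inner_wk h0 h1 h01
  -- p_i is not in Q (it would be orthogonal to itself)
  have hnotQ : wk x0 x1 i ∉ (Finset.range 5).image (wk y0 y1) := by
    intro h
    obtain ⟨j, hj, hj'⟩ := mem_wkSet.1 h
    have h1' := hcross i j hi hj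
    rw [← hj', real_inner_self_eq_norm_sq] at h1'
    have hn : ‖wk x0 x1 i‖ = 1 := by
      have := hg i i hi hi
      rw [real_inner_self_eq_norm_sq] at this
      interval_cases i <;> simp only [gv] at this <;> nlinarith [norm_nonneg (wk x0 x1 0), norm_nonneg (wk x0 x1 1),
        norm_nonneg (wk x0 x1 2), norm_nonneg (wk x0 x1 3), norm_nonneg (wk x0 x1 4)]
    rw [hn] at h1'
    norm_num at h1'
  have hdisj : Disjoint (((Finset.range 5).image (wk x0 x1)).erase (wk x0 x1 i)) ((Finset.range 5).image (wk y0 y1)) := by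
    rw [Finset.disjoint_left]
    intro z hz hzQ
    have hzP := Finset.mem_of_mem_erase hz
    obtain ⟨i', hi', rfl⟩ := mem_wkSet.1 hzP
    obtain ⟨j, hj, hj'⟩ := mem_wkSet.1 hzQ
    have h2 := hcross i' j hi' hj
    rw [← hj', real_inner_self_eq_norm_sq] at h2
    have := hg i' i' hi' hi'
    rw [real_inner_self_eq_norm_sq] at this
    rw [this] at h2
    interval_cases i' <;> simp only [gv] at h2 <;> norm_num at h2
  rw [hCeq, Finset.erase_union_distrib, Finset.erase_eq_of_notMem hnotQ, Finset.sum_union hdisj,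
    Finset.sum_erase_eq_sub (mem_wkSet.2 ⟨i, hi, rfl⟩), sum_image_wk h0 h1 h01 _ _ subset_rfl,
    sum_image_wk k0 k1 k01 _ _ subset_rfl]
  have hP : ∑ j ∈ Finset.range 5, a (inner ℝ (wk x0 x1 i) (wk x0 x1 j)) = a 1 + (2 * a ctwo + 2 * a cone) := by
    rw [← sum_gv_range a i hi]
    refine Finset.sum_congr rfl fun j hj => ?_
    rw [hg i j hi (by have := Finset.mem_range.1 hj; omega)]
  have hii : a (inner ℝ (wk x0 x1 i) (wk x0 x1 i)) = a 1 := by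
    rw [hg i i hi hi]
    interval_cases i <;> simp only [gv]
  have hQ : ∑ j ∈ Finset.range 5, a (inner ℝ (wk x0 x1 i) (wk y0 y1 j)) = 5 * a 0 := by
    rw [Finset.sum_congr rfl fun j hj => by rw [hcross i j hi (by have := Finset.mem_range.1 hj; omega)]]
    simp
  rw [hP, hii, hQ]
  ring

/-- **Energy of a ten-point code.** For every pair potential `a`: `Σ_{x ≠ y} a(⟪x,y⟫) = 10 (2 a(c₂) + 2 a(c₁) + 5 a(0))`
(each point has two partners at `cos 144°`, two at `cos 72°`, five orthogonal). -/
theorem energy_eq (hC : IsCode C) (h10 : C.card = 10) (a : ℝ → ℝ) :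
    ∑ x ∈ C, ∑ y ∈ C.erase x, a (inner ℝ x y) = 10 * (2 * a ctwo + 2 * a cone + 5 * a 0) := by
  classical
  obtain ⟨x0, x1, y0, y1, hx0, hx1, hy0, hy1, h01, hy01, hcross, hCeq⟩ := structure_thm hC h10
  have h0 := hC.norm_one x0 hx0
  have h1 := hC.norm_one x1 hx1
  have k0 := hC.norm_one y0 hy0
  have k1 := hC.norm_one y1 hy1
  have hcross' : ∀ i j, i ≤ 4 → j ≤ 4 → inner ℝ (wk y0 y1 i) (wk x0 x1 j) = 0 := by
    intro i j hi hj; rw [real_inner_comm]; exact hcross j i hj hi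
  have hCeq' : C = (Finset.range 5).image (wk y0 y1) ∪ (Finset.range 5).image (wk x0 x1) := by
    rw [hCeq, Finset.union_comm]
  have hrow : ∀ x ∈ C, ∑ y ∈ C.erase x, a (inner ℝ x y) = 2 * a ctwo + 2 * a cone + 5 * a 0 := by
    intro x hx
    rw [hCeq, Finset.mem_union] at hx
    rcases hx with hx | hx
    · obtain ⟨i, hi, rfl⟩ := mem_wkSet.1 hx
      exact row_sum h0 h1 h01 k0 k1 hy01 hcross hCeq a i hi
    · obtain ⟨j, hj, rfl⟩ := mem_wkSet.1 hx
      exact row_sum k0 k1 hy01 h0 h1 h01 hcross' hCeq' a j hj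
  rw [Finset.sum_congr rfl hrow, Finset.sum_const, h10, nsmul_eq_mul]
  norm_num

end Summit.Ventures.PackingBounds.Config.OrthogonalPentagonsUnique
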